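import Literature.AnabelianGeometry.SemiGraphs.PSCGraphicity
import HarnessLib

/-!
# [IUTchI] Remark 1.2.3 (vii), first sentence, PROVED: "Sufficiency is immediate" for [CombGC] Thm 1.6 (iii)

Mochizuki, *Inter-universal Teichmüller theory I*, Remark 1.2.3 (vii), kurims manuscript p. 43 (the
replacement text of the final paragraph of the proof of [CombGC] Theorem 1.6): "Finally, we consider
assertion (iii) [`β : Π^unr_G ⥲ Π^unr_H` is verticially filtration-preserving if and only if it is
group-theoretically verticial]. Sufficiency is immediate."  This proof-only file (abc-iut cell, layer
L5, abc-iut-L5-t6) makes "immediate" kernel-precise over abc-iut-L3-t4's interface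
(`SemiGraphs/PSCFundamentalGroup.lean`, `SemiGraphs/PSCGraphicity.lean`): for ANY `PSCDatum`s `G`, `H`
and any `β`, if `β` is group-theoretically verticial (`IsUnrGroupTheoreticallyVerticial`) then it is
verticially filtration-preserving (`IsUnrVerticiallyFiltrationPreserving`) —
`isUnrVerticiallyFiltrationPreserving_of_isUnrGroupTheoreticallyVerticial`.  The typed claim
`Rmk123.UnrVerticialSufficiency Ω` of `CoveringsErrata.lean` follows for every origin predicate `Ω`
(wrapper filed with that file's companion).

Mechanism (formal, no anabelian input): write `π_G : Π_G ↠ Π^unr_G`, `U ⊇ Ker π_G` open, `U'` the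
transported subgroup of `Π_H`.  Both sides of the filtration identity are `Ker π_H`-saturated closed
subgroups, so it suffices to compare images in `Π^unr_H`; images commute with topological closure
for saturated closed subgroups (quotient maps) and with `β` (a homeomorphism); the commutator parts
agree because `β π_G(U) = π_H(U')`, and the verticial parts agree generator by generator because
`π_G(U ∩ B) = π_G(U) ∩ π_G(B)` when `Ker ⊆ U` and `β` carries the images of verticial subgroups of
`Π_G` onto those of `Π_H` (both directions of `IsUnrGroupTheoreticallyVerticial`).  That the kernels
lie in the (closures of the) filtration subgroups uses only the interface law "every edge group is
conjugate into a vertex group" (`PSCDatum.cuspGp_le`, `nodeGp_le`).  No side is taken on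
[IUTchIII] Cor. 3.12; nothing printed is strengthened.
-/

noncomputable section

open scoped Pointwise
open Topology

namespace Literature.IUT.HodgeTheaters

namespace Rmk123

open Literature.AnabelianGeometry.SemiGraphs

universe u

variable {P : Type u} [Group P] [TopologicalSpace P] [IsTopologicalGroup P]
variable {P' : Type u} [Group P'] [TopologicalSpace P'] [IsTopologicalGroup P']

/-! ### Group-theoretic lemmas -/

/-- `f(S ∩ T) = f(S) ∩ f(T)` when `Ker f ⊆ S`. [cite: Mochizuki2012, IUTchI Rmk 1.2.3 (vii) p.43] -/
theorem map_inf_of_ker_le {A B : Type*} [Group A] [Group B] (f : A →* B) {S T : Subgroup A}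
    (h : f.ker ≤ S) : (S ⊓ T).map f = S.map f ⊓ T.map f := by
  refine le_antisymm (Subgroup.map_inf_le _ _ _) ?_
  rintro x ⟨⟨s, hs, hsx⟩, ⟨t, ht, htx⟩⟩
  refine ⟨t, ⟨?_, ht⟩, htx⟩
  have hst : s⁻¹ * t ∈ f.ker := by
    rw [MonoidHom.mem_ker, map_mul, map_inv, hsx, htx, inv_mul_cancel]
  have := S.mul_mem hs (h hst)
  simpa using this

/-- For the quotient map `π : Π ↠ Π/N` and a subgroup `T ⊇ N`: `π(closure T) = closure (π T)`.
[cite: Mochizuki2012, IUTchI Rmk 1.2.3 (vii) p.43] -/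
theorem map_mk_topologicalClosure {A : Type*} [Group A] [TopologicalSpace A] [IsTopologicalGroup A]
    (N : Subgroup A) [N.Normal] (T : Subgroup A) (hN : N ≤ T.topologicalClosure) :
    (T.topologicalClosure).map (QuotientGroup.mk' N) = (T.map (QuotientGroup.mk' N)).topologicalClosure := by
  refine le_antisymm ?_ ?_
  · rintro _ ⟨t, ht, rfl⟩
    have hcont : Continuous (QuotientGroup.mk' N : A → A ⧸ N) := QuotientGroup.continuous_mk
    rw [← SetLike.mem_coe, Subgroup.topologicalClosure_coe, Subgroup.coe_map]
    exact image_closure_subset_closure_image hcont ⟨t, ht, rfl⟩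
  · apply Subgroup.topologicalClosure_minimal _ (Subgroup.map_mono T.le_topologicalClosure)
    -- the image of the saturated closed subgroup `closure T` is closed
    have hq : IsQuotientMap (QuotientGroup.mk' N : A → A ⧸ N) := QuotientGroup.isQuotientMap_mk N
    rw [← hq.isClosed_preimage]
    have : (QuotientGroup.mk' N : A → A ⧸ N) ⁻¹'
        ((T.topologicalClosure).map (QuotientGroup.mk' N) : Set (A ⧸ N)) =
        (T.topologicalClosure : Set A) := by
      rw [← Subgroup.coe_comap, Subgroup.comap_map_eq, QuotientGroup.ker_mk', sup_eq_left.mpr hN]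
    rw [this]
    exact Subgroup.isClosed_topologicalClosure _

/-- A continuous multiplicative equivalence commutes with topological closure of subgroups.
[cite: Mochizuki2012, IUTchI Rmk 1.2.3 (vii) p.43] -/
theorem map_continuousMulEquiv_topologicalClosure {A B : Type*} [Group A] [TopologicalSpace A]
    [IsTopologicalGroup A] [Group B] [TopologicalSpace B] [IsTopologicalGroup B] (e : A ≃ₜ* B)
    (T : Subgroup A) :
    (T.topologicalClosure).map e.toMulEquiv.toMonoidHom =
      (T.map e.toMulEquiv.toMonoidHom).topologicalClosure := by
  apply SetLike.coe_injective
  simp only [Subgroup.coe_map, Subgroup.topologicalClosure_coe]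
  exact e.toHomeomorph.image_closure (T : Set A)

/-! ### The kernel `Ker(Π_G ↠ Π^unr_G)` lies in the verticial filtration subgroup of `U ⊇ Ker` -/

omit [IsTopologicalGroup P] in
/-- Every conjugate of an edge group lies in a verticial subgroup (interface laws `cuspGp_le`,
`nodeGp_le`). [cite: Mochizuki2012, IUTchI Rmk 1.2.3 (vii) p.43] -/
theorem exists_isVerticial_ge_of_mem_edge (G : PSCDatum P) {a : P}
    (ha : a ∈ (⋃ c, (G.cuspGp c : Set P)) ∪ ⋃ e, (G.nodeGp e : Set P)) (γ : ConjAct P) :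
    ∃ B : Subgroup P, G.IsVerticial B ∧ γ • a ∈ B := by
  rcases ha with ha | ha
  · obtain ⟨c, hc⟩ := Set.mem_iUnion.mp ha
    obtain ⟨γ₀, hγ₀⟩ := G.cuspGp_le c
    refine ⟨(γ * γ₀⁻¹) • G.vertGp (G.graph.cuspEnd c), ⟨_, _, rfl⟩, ?_⟩
    have h1 : γ • a ∈ (γ * γ₀⁻¹) • (γ₀ • G.cuspGp c) := by
      rw [smul_smul, mul_assoc, inv_mul_cancel, mul_one]
      exact Subgroup.smul_mem_pointwise_smul _ _ _ hc
    exact Subgroup.pointwise_smul_le_pointwise_smul_iff.mpr hγ₀ h1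
  · obtain ⟨e, he⟩ := Set.mem_iUnion.mp ha
    obtain ⟨v₁, v₂, -, ⟨γ₀, hγ₀⟩, -⟩ := G.nodeGp_le e
    refine ⟨(γ * γ₀⁻¹) • G.vertGp v₁, ⟨_, _, rfl⟩, ?_⟩
    have h1 : γ • a ∈ (γ * γ₀⁻¹) • (γ₀ • G.nodeGp e) := by
      rw [smul_smul, mul_assoc, inv_mul_cancel, mul_one]
      exact Subgroup.smul_mem_pointwise_smul _ _ _ he
    exact Subgroup.pointwise_smul_le_pointwise_smul_iff.mpr hγ₀ h1

/-- If `Ker(Π_G ↠ Π^unr_G) ⊆ U` then the normal closure of the edge groups lies in `vertGen U`.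
[cite: Mochizuki2012, IUTchI Rmk 1.2.3 (vii) p.43] -/
theorem normalClosure_edges_le_vertGen (G : PSCDatum P) {U : Subgroup P} (hU : G.unrKer ≤ U) :
    Subgroup.normalClosure ((⋃ c, (G.cuspGp c : Set P)) ∪ ⋃ e, (G.nodeGp e : Set P)) ≤
      ⁅U, U⁆ ⊔ ⨆ A : {A : Subgroup P // G.IsVerticialIn U A}, (A : Subgroup P) := by
  -- the normal closure is generated by the conjugates of edge-group elements
  change Subgroup.closure _ ≤ _
  rw [Subgroup.closure_le]
  intro x hx
  obtain ⟨a, ha, hax⟩ := Group.mem_conjugatesOfSet_iff.mp hx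
  obtain ⟨g, rfl⟩ := isConj_iff.mp hax
  -- `x = g a g⁻¹` lies in a verticial subgroup `B` …
  obtain ⟨B, hB, hxB⟩ := exists_isVerticial_ge_of_mem_edge G ha (ConjAct.toConjAct g)
  rw [ConjAct.toConjAct_smul] at hxB
  -- … and in `Ker ⊆ U`
  have hxK : g * a * g⁻¹ ∈ G.unrKer := by
    apply Subgroup.le_topologicalClosure
    exact Subgroup.conjugatesOfSet_subset_normalClosure hx
  have hxA : g * a * g⁻¹ ∈ ((⟨U ⊓ B, B, hB, rfl⟩ : {A : Subgroup P // G.IsVerticialIn U A}) :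
      Subgroup P) := ⟨hU hxK, hxB⟩
  exact Subgroup.mem_sup_right (Subgroup.mem_iSup_of_mem _ hxA)

/-- If `Ker(Π_G ↠ Π^unr_G) ⊆ U` then `Ker ⊆ vertFil U`. [cite: Mochizuki2012, IUTchI Rmk 1.2.3 (vii) p.43] -/
theorem unrKer_le_vertFil (G : PSCDatum P) {U : Subgroup P} (hU : G.unrKer ≤ U) :
    G.unrKer ≤ G.vertFil U :=
  Subgroup.topologicalClosure_mono (normalClosure_edges_le_vertGen G hU)

/-! ### The transport along `β` -/

omit [IsTopologicalGroup P] [IsTopologicalGroup P'] in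
/-- `π_H (transport S) = β (π_G S)`. [cite: MochizukiCombGC2007, Def 1.4 p.10] -/
theorem map_mk_unrTransport [IsTopologicalGroup P] [IsTopologicalGroup P'] (G : PSCDatum P)
    (H : PSCDatum P') (β : (P ⧸ G.unrKer) ≃ₜ* (P' ⧸ H.unrKer)) (S : Subgroup P) :
    (G.unrTransport H β S).map (QuotientGroup.mk' H.unrKer) =
      (S.map (QuotientGroup.mk' G.unrKer)).map β.toMulEquiv.toMonoidHom := by
  rw [PSCDatum.unrTransport, Subgroup.map_comap_eq, MonoidHom.range_eq_top.mpr
    (QuotientGroup.mk'_surjective _), top_inf_eq]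

omit [IsTopologicalGroup P] [IsTopologicalGroup P'] in
/-- `Ker(Π_H ↠ Π^unr_H) ⊆ transport S`. [cite: MochizukiCombGC2007, Def 1.4 p.10] -/
theorem unrKer_le_unrTransport [IsTopologicalGroup P] [IsTopologicalGroup P'] (G : PSCDatum P)
    (H : PSCDatum P') (β : (P ⧸ G.unrKer) ≃ₜ* (P' ⧸ H.unrKer)) (S : Subgroup P) :
    H.unrKer ≤ G.unrTransport H β S := by
  intro x hx
  rw [PSCDatum.unrTransport, Subgroup.mem_comap]
  have : (QuotientGroup.mk' H.unrKer) x = 1 := by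
    rw [← MonoidHom.mem_ker, QuotientGroup.ker_mk']; exact hx
  rw [this]
  exact Subgroup.one_mem _

/-- Under a group-theoretically verticial `β`, the `β`-image of `π_G` of a verticial subgroup of
`Π_G` is `π_H` of a verticial subgroup of `Π_H`. [cite: Mochizuki2012, IUTchI Rmk 1.2.3 (vii) p.43] -/
theorem exists_isVerticial_map_eq (G : PSCDatum P) (H : PSCDatum P')
    (β : (P ⧸ G.unrKer) ≃ₜ* (P' ⧸ H.unrKer)) (hβ : G.IsUnrGroupTheoreticallyVerticial H β)
    {B : Subgroup P} (hB : G.IsVerticial B) :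
    ∃ C : Subgroup P', H.IsVerticial C ∧
      (B.map (QuotientGroup.mk' G.unrKer)).map β.toMulEquiv.toMonoidHom =
        C.map (QuotientGroup.mk' H.unrKer) := by
  obtain ⟨C, hC, hBC⟩ := hβ.1 (B ⊔ G.unrKer) ⟨B, hB, rfl⟩
  refine ⟨C, hC, ?_⟩
  have hG0 : (G.unrKer).map (QuotientGroup.mk' G.unrKer) = ⊥ :=
    (Subgroup.map_eq_bot_iff _).mpr (by rw [QuotientGroup.ker_mk'])
  have hH0 : (H.unrKer).map (QuotientGroup.mk' H.unrKer) = ⊥ :=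
    (Subgroup.map_eq_bot_iff _).mpr (by rw [QuotientGroup.ker_mk'])
  have h1 := map_mk_unrTransport G H β (B ⊔ G.unrKer)
  rw [hBC, Subgroup.map_sup, Subgroup.map_sup, hG0, hH0, sup_bot_eq, sup_bot_eq] at h1
  exact h1.symm

/-- Conversely, `π_H` of every verticial subgroup of `Π_H` is the `β`-image of `π_G` of a verticial
subgroup of `Π_G`. [cite: Mochizuki2012, IUTchI Rmk 1.2.3 (vii) p.43] -/
theorem exists_isVerticial_map_eq' (G : PSCDatum P) (H : PSCDatum P')
    (β : (P ⧸ G.unrKer) ≃ₜ* (P' ⧸ H.unrKer)) (hβ : G.IsUnrGroupTheoreticallyVerticial H β)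
    {C : Subgroup P'} (hC : H.IsVerticial C) :
    ∃ B : Subgroup P, G.IsVerticial B ∧
      (B.map (QuotientGroup.mk' G.unrKer)).map β.toMulEquiv.toMonoidHom =
        C.map (QuotientGroup.mk' H.unrKer) := by
  obtain ⟨Bu, ⟨B, hB, rfl⟩, hBC⟩ := hβ.2 (C ⊔ H.unrKer) ⟨C, hC, rfl⟩
  refine ⟨B, hB, ?_⟩
  have hG0 : (G.unrKer).map (QuotientGroup.mk' G.unrKer) = ⊥ :=
    (Subgroup.map_eq_bot_iff _).mpr (by rw [QuotientGroup.ker_mk'])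
  have hH0 : (H.unrKer).map (QuotientGroup.mk' H.unrKer) = ⊥ :=
    (Subgroup.map_eq_bot_iff _).mpr (by rw [QuotientGroup.ker_mk'])
  have h1 := map_mk_unrTransport G H β (B ⊔ G.unrKer)
  rw [hBC, Subgroup.map_sup, Subgroup.map_sup, hG0, hH0, sup_bot_eq, sup_bot_eq] at h1
  exact h1.symm

/-- Step B: `β (π_G ([U,U]·⨆(U ∩ verticial))) = π_H ([U',U']·⨆(U' ∩ verticial))` for `U ⊇ Ker`,
`U'` the transport of `U`. [cite: Mochizuki2012, IUTchI Rmk 1.2.3 (vii) p.43] -/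
theorem map_vertGen_eq (G : PSCDatum P) (H : PSCDatum P')
    (β : (P ⧸ G.unrKer) ≃ₜ* (P' ⧸ H.unrKer)) (hβ : G.IsUnrGroupTheoreticallyVerticial H β)
    {U : Subgroup P} (hU : G.unrKer ≤ U) :
    ((⁅U, U⁆ ⊔ ⨆ A : {A : Subgroup P // G.IsVerticialIn U A}, (A : Subgroup P)).map
        (QuotientGroup.mk' G.unrKer)).map β.toMulEquiv.toMonoidHom =
      (⁅G.unrTransport H β U, G.unrTransport H β U⁆ ⊔
        ⨆ A' : {A' : Subgroup P' // H.IsVerticialIn (G.unrTransport H β U) A'}, (A' : Subgroup P')).map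
        (QuotientGroup.mk' H.unrKer) := by
  set U' := G.unrTransport H β U with hU'def
  have hU' : H.unrKer ≤ U' := unrKer_le_unrTransport G H β U
  have hπU : (U.map (QuotientGroup.mk' G.unrKer)).map β.toMulEquiv.toMonoidHom =
      U'.map (QuotientGroup.mk' H.unrKer) := (map_mk_unrTransport G H β U).symm
  have hkerG : (QuotientGroup.mk' G.unrKer).ker ≤ U := by rw [QuotientGroup.ker_mk']; exact hU
  have hkerH : (QuotientGroup.mk' H.unrKer).ker ≤ U' := by rw [QuotientGroup.ker_mk']; exact hU'
  have hβinj : Function.Injective β.toMulEquiv.toMonoidHom := β.injective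
  simp only [Subgroup.map_sup, Subgroup.map_commutator, Subgroup.map_iSup, hπU]
  congr 1
  refine le_antisymm ?_ ?_
  · refine iSup_le fun A => ?_
    obtain ⟨A, B, hB, rfl⟩ := A
    obtain ⟨C, hC, hBC⟩ := exists_isVerticial_map_eq G H β hβ hB
    have : ((U ⊓ B).map (QuotientGroup.mk' G.unrKer)).map β.toMulEquiv.toMonoidHom =
        (U' ⊓ C).map (QuotientGroup.mk' H.unrKer) := by
      rw [map_inf_of_ker_le _ hkerG, Subgroup.map_inf _ _ _ hβinj, hπU, hBC,
        map_inf_of_ker_le _ hkerH]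
    rw [this]
    exact le_iSup_of_le ⟨U' ⊓ C, C, hC, rfl⟩ le_rfl
  · refine iSup_le fun A' => ?_
    obtain ⟨A', C, hC, rfl⟩ := A'
    obtain ⟨B, hB, hBC⟩ := exists_isVerticial_map_eq' G H β hβ hC
    have : (U' ⊓ C).map (QuotientGroup.mk' H.unrKer) =
        ((U ⊓ B).map (QuotientGroup.mk' G.unrKer)).map β.toMulEquiv.toMonoidHom := by
      rw [map_inf_of_ker_le _ hkerG, Subgroup.map_inf _ _ _ hβinj, hπU, hBC,
        map_inf_of_ker_le _ hkerH]
    rw [this]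
    exact le_iSup_of_le ⟨U ⊓ B, B, hB, rfl⟩ le_rfl

/-! ### The theorem -/

/-- **[IUTchI] Remark 1.2.3 (vii)** ("Sufficiency is immediate" for [CombGC] Thm. 1.6 (iii)), PROVED
over the interface, for all `PSCDatum`s and all `β : Π^unr_G ≅ Π^unr_H`: group-theoretically
verticial ⇒ verticially filtration-preserving.
[cite: Mochizuki2012, IUTchI Rmk 1.2.3 (vii) p.43] -/
theorem isUnrVerticiallyFiltrationPreserving_of_isUnrGroupTheoreticallyVerticial (G : PSCDatum P)
    (H : PSCDatum P') (β : (P ⧸ G.unrKer) ≃ₜ* (P' ⧸ H.unrKer))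
    (hβ : G.IsUnrGroupTheoreticallyVerticial H β) :
    G.IsUnrVerticiallyFiltrationPreserving H β := by
  intro U _hUopen hU
  set U' := G.unrTransport H β U with hU'def
  have hU' : H.unrKer ≤ U' := unrKer_le_unrTransport G H β U
  -- compare the two `Ker_H`-saturated subgroups through their images in `Π^unr_H`
  have hL : G.unrTransport H β (G.vertFil U) =
      (((G.vertFil U).map (QuotientGroup.mk' G.unrKer)).map β.toMulEquiv.toMonoidHom).comap
        (QuotientGroup.mk' H.unrKer) := rfl
  have hR : H.vertFil U' =
      ((H.vertFil U').map (QuotientGroup.mk' H.unrKer)).comap (QuotientGroup.mk' H.unrKer) := by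
    rw [Subgroup.comap_map_eq, QuotientGroup.ker_mk', sup_eq_left.mpr (unrKer_le_vertFil H hU')]
  rw [hL, hR]
  congr 1
  -- images: closure commutes with `π_G`, `β`, `π_H`
  simp only [PSCDatum.vertFil]
  rw [map_mk_topologicalClosure G.unrKer _ (unrKer_le_vertFil G hU),
    map_continuousMulEquiv_topologicalClosure,
    map_mk_topologicalClosure H.unrKer _ (unrKer_le_vertFil H hU'),
    map_vertGen_eq G H β hβ hU]

end Rmk123

end Literature.IUT.HodgeTheaters

end
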